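import Literature.MathematicalPhysics.QuantumFieldTheory.Balaban1983to89.B8Ineq198MultiLevelTorusL0
import Literature.MathematicalPhysics.QuantumFieldTheory.Balaban1983to89.B6GlobalChartV1L0
import Literature.MathematicalPhysics.QuantumFieldTheory.Balaban1983to89.B6SectAVectorModelV1
import Literature.MathematicalPhysics.QuantumFieldTheory.Balaban1983to89.B6Geom246MultiLevelBoxL0
import Literature.MathematicalPhysics.QuantumFieldTheory.Balaban1983to89.B6Geom246MultiLevelTorusL0
import Literature.MathematicalPhysics.QuantumFieldTheory.Balaban1983to89.B6MultiLevelBoxOperatorL0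
import Literature.MathematicalPhysics.QuantumFieldTheory.Balaban1983to89.B6MultiLevelTorusOperatorL0
import Literature.MathematicalPhysics.QuantumFieldTheory.Balaban1983to89.B8Ineq192MultiLevelTorusL0
import Literature.MathematicalPhysics.QuantumFieldTheory.Balaban1983to89.B8Ineq159MultiLevelTorus

/-!
# `Balaban1983to89.B8Ineq159MultiLevelTorusL0` — LEVEL-0 TWIN (programme G-F3′-L0, sub-row G-F3′-L0∕B8 «N05 cone»; director-ym LINE №27 ∕ №35, UV3-NODE §24.5; plan `lit-balaban-r03/G-F3L0-PLAN.md`, row log `lit-balaban-lead/ROW-G-F3p-L0.md` §7) of `B8Ineq159MultiLevelTorus`: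
the same declarations, SAME NAMES AND STATEMENTS, for nested families WITH print's region `Λ₀ = T ∖ Ω₁` ADMITTED (structures
`B6MultiLevelBoxOperatorL0.Domains` / `B6MultiLevelTorusOperatorL0.TDomains`: levels `0, …, k`, the level-`0` block a single site, `Q′₀ = id`,
finite weight `a₀` — print p.225 (2.14) «Σ_{j=0}^k … (Q′₀λ)(x) = λ(x), x ∈ Λ₀», p.229 «taking a sequence (2.1) … smallest possible domains B^j(Λ_j),
and considering the operator Δ_a defined by (2.19), (2.20) for this sequence»).  Every `D`-free object is the lineage's, consumed BY NAME; no existing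
module is touched; no fact is minted.  Unit `lit-balaban-p38` (p38 gen 36; second hand of sub-row G-F3′-L0∕B8 «N05 cone» — director-ym №35 2026-08-27T23:07:41Z, OWNER `lit-balaban-r05`, consumer pub-ymgap∕dag-n05-c by endpoint name; port discipline and tooling r03 gen 36∕37, PLAN v1.5); B8 fold owner r05, B9 fold owner r06; referee ref-4.  THE TWIN'S DOCUMENTATION FOLLOWS
VERBATIM (its «levels 1 … k» / «Ω₁ = X» sentences describe the twin; here `j` runs from `0` and `Ω₁` may be a proper subset).

# `Balaban1983to89.B8Ineq159MultiLevelTorus` — T. Bałaban, *Spaces of regular gauge field configurations on a lattice and gauge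
# fixing conditions*, Commun. Math. Phys. **99** (1985) 75–102 [Balaban1985RegularSpaces], **(1.59)** p. 86 «Theorem 3.3 of [4]
# implies the bounds |A|₍₋₁₎, |∇^η_{U₀}A|₍₋₂₎, |D^{η*}_{U₀}D^η_{U₀}A|₍₋₃₎, |Δ^η_{U₀}A|₍₋₃₎ ≦ B₀(|J|₍₋₃₎ + |B₁|)» — THE THREE PROPAGATOR
# MEMBERS IN OPERATOR FORM «|G(U₀)X|₍₋₁₎, |∇_{U₀}G(U₀)X|₍₋₂₎, |Δ_{U₀}G(U₀)X|₍₋₃₎ ≦ B₀|X|₍₋₃₎» (= [4] (3.47), entries 1, 2, 4, at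
# γ = −3, and here at every γ = −n) **AT THE FLAT BACKGROUND U₀ = 1 ON THE `k`-LEVEL TORUS, VECTOR SIDE**, the [B6] Proposition 2.6
# (2.136)-shape majorants of `G(1)`, `∇G(1)`, `ΔG(1)` ENTERING AS ARGUMENTS — carrier-generic (any lattice carrier with a block map into
# p21's `𝔅` of the `k`-level torus family) and read on r03's fine vector-field carrier `PBond (PV …) 0` / `blkV1` of the V1 global torus

statement-level skeleton of published theorems with citation tags; proofs where landed; nothing here is a claim about the Yang–Mills mass gap

PDF held: `paper:balaban1985-cmp99-regular-spaces-gauge-fixing` (journal page = PDF page + 74); p. 86 [PDF 12] / p. 87 [PDF 13] re-read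
this generation on the text layer (`lit read … --pages 12-13`, p0012.txt / p0013.txt; the displays (1.58)–(1.59) are quoted below in the
wording verified AS AN IMAGE by this seat's lineage for the one-level twin `B8Ineq159FlatTorus`, render
`run/shared/lean/pub/pub-balaban/b2b-balaban-ref1/pages/1985-cmp99-regular-spaces-gauge-fixing-p012-x2.png`); [B6] = T. Bałaban,
*Propagators and renormalization transformations for lattice gauge theories. II*, Commun. Math. Phys. **96** (1984) 223–250
[Balaban1984PropagatorsII], p. 247 [PDF 25] re-read this generation (`paper:balaban1984-cmp96-propagators-rt-ii` p0025.txt); [4] =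
T. Bałaban, *Propagators for lattice gauge theories in a background field*, Commun. Math. Phys. **99** (1985) 389–434
[Balaban1985BackgroundPropagators] pp. 397–399 through the verbatim quotations of this seat's `B8Ineq198MultiLevelTorus` /
`B8Ineq159FlatTorus` (referee-signed).

CITATION HEADER (lean-in-tree rule).  Cell `lit-balaban` (HOME `run/shared/lean/pub/lit-balaban/`), unit `lit-balaban-r05` gen 61 (B8
reader/typer and fold owner; free target under protocol G.5-34(d), successor trigger (iii-d) of HOME/lit-balaban-r05/HANDOFF.md § gen 60:
the vector-side continuation of `B8Ineq192MultiLevelTorus` p342575 / `B8Ineq198MultiLevelTorus` p344001, armed by r03 gen 20's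
`B6Prop26KLevelSkeletonV1` (the `k`-level (2.136)₁ assembly skeleton on the V1 torus, whose conclusion has exactly the `HasMajorant` shape
consumed here)).  WHAT IS REPRODUCED = SKELETON row **B8.Eq1.59** (cells; the three propagator members, operator form) with a courtesy
reading of [4] (3.47) at `U = 1` (row B9.Eq3.47, r06), as «kernel-checked proofs of a model instance» on the multi-level flat TORUS carriers
of p21's `B6MultiLevelTorusOperator` / `B6Geom246MultiLevelTorus` (`TDomains d ℓ M_h k P R`, `Ω₁ = T_η`; [B6] p. 224 «we admit the case when
some domains Ω_j are equal to T_η») and, for the vector fields, r03's V1 global torus `B6GlobalChartV1` (`PV`, `toBox`, `blkV1`).  THE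
ANALYTIC INPUT ENTERS AS AN ARGUMENT (the device of the scalar predecessors `B8Ineq192MultiLevelBox` (gen 43, «G as argument») and
`B8Ineq198MultiLevelTorus`; D-0026: hypotheses of theorems, no `… : Prop` fact minted): the [B6] Prop. 2.6 majorants of `G(1)`, `∇G(1)`,
`ΔG(1)` in the `HasMajorant` shapes with the printed prefactors `(Lʲη)²`, `Lʲη`, `1` — for ARBITRARY linear operators `T` on the functions
of an ARBITRARY carrier with a block map into `𝔅`.  Their inhabitant for the genuine `k`-level `G(1) = Δ_a⁻¹` of [B6] (2.19)/(2.22) on the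
V1 torus is r03's ROUTE V (B6-CLOSURE §5 items 7–13; (2.136)₁: `B6GlobalChartV1L0.prop26_2136_V1_of_2134_eq291`,
`B6Prop26KLevelSkeletonV1L0.prop26_2136_kLevel_skeleton` — members still hypotheses there; (2.136)₂,₄ not begun); the hypothesis-free
`…P26` twin of this file follows its landing, as `B8Ineq192MultiLevelTorusP23` followed p21's Prop. 2.3.  Theorems only; 0 `def`; every
input BY NAME; 0 sorry; imports `B8Ineq198MultiLevelTorus` (own scalar torus engine), `B6GlobalChartV1` (r03), `B6SectAVectorModelV1` (p21).

WHAT IS PRINTED (verbatim).  B8 p. 86 [PDF 12]: *"They imply finally A = G(U₀)J − G(U₀)D^{η*}_{U₀}D_{U₀}H(U₀)B₁ + H(U₀)B₁ =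
G(U₀)J + G(U₀)Σ_jQ*_jΛ_j(L^jη)⁻³B₁, (1.58) where the operator G(U₀) was introduced and investigated in [4]. Let us recall only the
definition: G(U₀) = (D^{η*}_{U₀}D^η_{U₀} + D^η_{U₀}R(U₀)D^{η*}_{U₀} + Σ_jQ*_jΛ_j(L^jη)⁻²Q_j)⁻¹.  Theorem 3.3 of [4] implies the bounds:
|A|₍₋₁₎, |∇^η_{U₀}A|₍₋₂₎, |D^{η*}_{U₀}D^η_{U₀}A|₍₋₃₎, |Δ^η_{U₀}A|₍₋₃₎ ≦ B₀(|J|₍₋₃₎ + |B₁|) ≦ … (1.59)"*; p. 86, after (1.55): *"where the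
norms | |₍α₎ were introduced in [4]. For the reader's convenience let us recall the definition: |A|₍α₎ = sup_j sup_{Ω_j}(L^jη)^{−α}|A|."*;
Prop. 3 p. 87 [PDF 13]: *"where B₀, B₀(β₀) are the corresponding norms of the operators G(U₀), H(U₀), and depend on d and L only, B₀(β₀) on β₀
also."*  [4] p. 398, (3.47): *"and the global inequalities |G′(U)λ|₍₂₊γ₎, |∇_UG′(U)λ|₍₁₊γ₎, |G′(U)∇*_Uλ|₍₁₊γ₎, |∇_UG′(U)λ|₍γ₎ ≦ B₀|λ|₍γ₎
(3.47) for γ in a fixed compact subset of real numbers, e.g. for γ ∈ [−4, 4]."*; [4] p. 398: *"Using Lemma 2.1 in [4] we may replace the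
factor (Lʲη)^α by (Lʲη)^β(L^{j′}η)^γ with β + γ = α"*; [4] p. 399, Theorem 3.3: *"Under the assumptions of Theorem 3.1, and with the
constants described there, the operator G(U) (a = 1) satisfies the inequalities (3.42)–(3.47), with G′(U) replaced by G(U) and λ replaced by
a function J defined at bonds of the lattice T_η, or Ω₀, and with values in 𝔤."*; [4] p. 399: *"This way the theorems are reduced to the
corresponding theorems for propagators without external gauge field. They were proved in [4]."* ([4] of [4] = [B5]/[B6]).  [B6] p. 247
[PDF 25], Proposition 2.6: *"There exists a positive constant δ₃ depending on d and L only, such that |(GJ)(x)|, |(∇GJ)(x)|, |(G∇*J)(x)|,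
|(ΔGJ)(x)| ≦ O(1)[(Lʲη)², Lʲη, Lʲη, 1]e^{−δ₃d(y,y′)}|J| (2.136) for x ∈ Δ(y), y ∈ Λ_j, supp J ⊂ Δ(y′), with the constant O(1) depending on
d and L only"*; [B6] p. 226: *"Δ_a = ∂*∂ + ∂R∂* + Q*aQ (2.19)"* (the no-external-field form of the operator inverted in (1.58)).

THE INSTANCE (dictionary print ↦ Lean).  Background `U₀ = 1`, so `∇^η_{U₀}`, `Δ^η_{U₀}`, `D^η_{U₀}` are the flat lattice operators and
`G(U₀)` of (1.58) is [B6]'s `G = Δ_a⁻¹` of (2.19)/(2.22) with `a_j = (Lʲη)⁻²` ([4] p. 399).  Lattice units at the finest level (`η = 1`,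
`Lʲη ↦ Lʲ = (geomT D).len y` for a block `y ∈ Λ_j`, p21's `B6Geom246MultiLevelTorusL0.geomT`; `(geomT D).eta = 1`), as in every torus file
of this lineage.  The `k`-level nested torus family `Ω₁ = T_η ⊃ Ω₂ ⊃ … ⊃ Ω_k` with (2.1)–(2.2) is p21's `D : TDomains d ℓ M_h k P R`
(`L = ℓ + 1`, torus side `N_μ = M_hL^{k+1}P_μ`), its blocks `𝔅 = ↥(bset D.toDomains)` (pairs (level, label)), multiscale distance
`(geomT D).dist` = (2.46).  A CARRIER is any type `X` of lattice objects with a BLOCK MAP `blk : X → 𝔅` («x ∈ Δ(y)» ⟺ `blk x = y`; the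
level of `x` is `(blk x).1.1`); the p. 86 norm at `α = −n ≤ 0` reads pointwise as «|u|₍₋ₙ₎ ≦ S ⟺ |u(z)| ≦ S·(L^{j(z)})⁻ⁿ for all z»
([4] p. 397 «For α negative we can take Ω_j instead of Ω_j∖Ω_{j+1}»; §4 below proves the equivalence with the typed norm
`B8ScaledSupNorm.msup (ℓ+1) k 1 (−n) (Ω_j := {z : j ≤ (blk z).1.1})` on finite carriers).  (2.136) for an operator `T` on `X → ℝ` is
`B6RandomWalk.HasMajorant (g := geomT D) blk T (y, y′ ↦ C·((geomT D).len y)^p·e^{−σ d_T(y,y′)})` with `p = 2, 1, 1, 0` for `T = G`, `∇_νG`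
(any component), `G∇*`, `ΔG` («|(Tμ)(x)| ≦ K(y(x), y′)·|μ| for supp μ ⊂ Δ(y′)»).  THE VECTOR SIDE: r03's V1 global torus
`PV d ℓ m K hd hL : Params` (dimension `d + 1`, `2L^{m+K}` sites per direction) carries the multi-level `Δ_a`/`G = Δ_a⁻¹` of (2.19)
(`B6SectAVectorModelV1.deltaAE`/`GE` over `B6GlobalChartV1L0.domT hN D hk`), the fine VECTOR FIELDS are the bond functions
`PBond (PV d ℓ m K hd hL) 0 → ℝ`, and the block map is `B6GlobalChartV1L0.blkV1 hN D b = y(b₋)` (the block of p21's family containing the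
chart point of the bond's initial point; `hN` = «the fundamental box IS the torus»); r03's (2.136)₁ skeleton concludes
`HasMajorant (g := geomT D) (blkV1 hN D) (onFun (GE (domT hN D hk) hcf hw)) (y, y′ ↦ K·pref cf y·e^{−δ₃d_T(y,y′)})` with
`pref cf y = (L^{j(y)}/c′)² = c′⁻²·((geomT D).len y)²` — the `p = 2` hypothesis of this file with `C := K·c′⁻²` (`hasMajorant_mono`).

WHAT THIS FILE PROVES (theorems only; imports `B8Ineq198MultiLevelTorus` (the scalar engine on the torus: `rowSum_and_thresholdT`, and
through it `B8Ineq192MultiLevelTorusL0.inv_pow_lenT_le`, `B8Ineq192MultiLevelBox.abs_apply_le_of_levelBound`/`levelRowSum_le`, p21's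
`lemma21_torus`) and `B6GlobalChartV1` (r03's V1 carrier, BY NAME)).
* §1 `apply_le_of_invPow_blk` — the CARRIER-GENERIC twin of `B8Ineq198MultiLevelTorusL0.apply_le_of_invPowT`: a block majorant
  `C·p(y)·e^{−σd_T}` applied to a `(Lʲ)⁻ⁿ`-weighted input on ANY carrier `X` with ANY block map `blk : X → 𝔅` gives
  `|(Tu)(x)| ≦ A·C·p(y(x))·(Lⁿc)·(L^{j(x)})⁻ⁿ` under (2.60)/(2.61) ((2.52)–(2.55) + «using again Lemma 2.1»).
* §2 **`sup347_of_majorant`** — [4] (3.47) AT U = 1 FROM A (2.136)-SHAPE MAJORANT, every prefactor exponent `p` and weight exponent `n`: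
  for all `C, σ > 0` and `n` there are `B₀ > 0`, `N₁ ≥ 1` (functions of `d, ℓ, C, σ, n`; NOT of `p`, the torus, its size, `k` or the
  carrier) such that for every `k`, `M_h ≥ 1`, `R` with `R·L·M_h ≥ N₁ + 1`, `P_μ ≥ 1`, every `D : TDomains`, every `p`, every carrier `X`,
  block map `blk`, operator `T` with `HasMajorant (geomT D) blk T (C·len^p·e^{−σd_T})` and every `u` with `|u(z)| ≦ S·(L^{j(z)})⁻ⁿ`:
  `|(Tu)(x)| ≦ B₀·(L^{j(x)})^p·(L^{j(x)})⁻ⁿ·S` — i.e. «T : |·|₍₋ₙ₎ → |·|₍₋ₙ₊ₚ₎ with norm ≦ B₀».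
* §3 **`ineq159_multiLevelTorus_V1`** — (1.59), THE THREE PROPAGATOR MEMBERS IN OPERATOR FORM, AT U₀ = 1 ON THE `k`-LEVEL V1 TORUS: for
  all `C, σ > 0`, `n` there are `B₀, N₁` as above such that for every admissible torus datum (`k, M_h, R, P′`, `D`, any V1 volume `m, K`
  with `hN`) and EVERY three operators `Gv`, `DGv ν` (`ν` a fine direction), `LGv` on the vector fields `PBond (PV …) 0 → ℝ` carrying the
  (2.136) majorants with prefactors `len²`, `len`, `1` on `blkV1 hN D`, every vector field `X` with `|X(b)| ≦ S·(L^{j(b)})⁻ⁿ`: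
  `|(Gv X)(b)| ≦ B₀(L^{j(b)})²(L^{j(b)})⁻ⁿS`, `|(DGv ν X)(b)| ≦ B₀L^{j(b)}(L^{j(b)})⁻ⁿS`, `|(LGv X)(b)| ≦ B₀(L^{j(b)})⁻ⁿS`;
  **`ineq159_multiLevelTorus_V1_three`** — `n = 3`, THE PRINTED EXPONENTS OF (1.59): `|(G(1)X)(b)| ≦ B₀S(L^{j(b)})⁻¹`,
  `|(∇_νG(1)X)(b)| ≦ B₀S(L^{j(b)})⁻²`, `|(ΔG(1)X)(b)| ≦ B₀S(L^{j(b)})⁻³` for `|X|₍₋₃₎ ≦ S`.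
* §4 IN PRINT'S OWN NORM `|·|₍α₎` of p. 86 (`B8ScaledSupNorm.msup`) on a finite carrier: the dictionary `bdd_blk`, `pointwise_of_msup_le_blk`,
  `msup_le_of_pointwise_blk` (twins of the box file's, reading only the block map) and **`ineq159_multiLevelTorus_V1_msup`** —
  «|G(1)X|₍₋₁₎ ≦ B₀|X|₍₋₃₎, |∇_νG(1)X|₍₋₂₎ ≦ B₀|X|₍₋₃₎, |ΔG(1)X|₍₋₃₎ ≦ B₀|X|₍₋₃₎» symbol for symbol, under the same hypotheses.
* §5 **`eq158_line2_V1`** — (1.57) ⟹ (1.58), LINE 2, FOR THE GENUINE MULTI-LEVEL VECTOR OPERATOR of p21's V1 calculus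
  (`B6SectAVectorModelV1`: `Δ_a = ∂*∂ + ∂R∂* + Q*aQ` (2.19), `G = GE = Δ_a⁻¹` (2.22)), every nested family `Domains P`, any `k`: from
  (1.55) `∂*∂A = J`, (1.42) `R∂*A = 0`, (1.56) `QA = B` (the rescaled datum on `𝔅`), **`A = G(1)(J + Q*aB)`** (one line from `GΔ_a = 1`);
  **`ineq159_A_member_V1`** — hence THE `|A|₍₋₁₎` MEMBER OF (1.59) FOR THE GENUINE `k`-LEVEL `G(1)` of r03's V1 reading `domT hN D hk`
  of p21's torus family, MODULO the (2.136)₁ majorant of `onFun (GE (domT hN D hk) hc′ hw)` on `blkV1 hN D` — precisely the conclusion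
  shape of r03's ROUTE V skeleton —: `|A(b)| ≦ B₀(Lʲ)²(Lʲ)⁻ⁿS` whenever `|(J + Q*aB)(b′)| ≦ S(L^{j′})⁻ⁿ` (`n = 3`: `|A|₍₋₁₎ ≦ B₀|J + Q*aB|₍₋₃₎`).

HONEST SCOPE / NOT CLAIMED.  (i) OPERATOR FORM (+ the (1.58) identity): what is proved is «G(U₀) : |·|₍₋₃₎ → |·|₍₋₁₎» etc. at
`U₀ = 1` (Prop. 3's «B₀ … the corresponding norms of the operators G(U₀)») and, for the genuine operator, (1.58) line 2 and the resulting
`|A|₍₋₁₎ ≦ B₀|J + Q*aB|₍₋₃₎`; the SIZE of (1.58)'s second summand, `|Σ_jQ*_jΛ_j(Lʲη)⁻³B₁|₍₋₃₎ ≦ O(1)|B₁|` (column mass of the iterated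
vector averages — print's volume-weighted adjoints `Q*_j`, cf. `BIJ85Eq213Adjoint.Qstar` for one step — and which levels' `Λ_j`-bonds cover
a fine bond under (2.2)), is NOT typed here — so Proposition 3 / (1.60)–(1.62) at `k` levels (`B8.apriori_160/162` on top of (1.59)) is
not assembled in this file (the one-level twins are `B8Eq158FlatTorus`, `B8Ineq159FlatTorus.norm_QvAdj_mulVec_le`/`prop3_flat`).  (ii) The member `|D^{η*}_{U₀}D^η_{U₀}A|₍₋₃₎` of (1.59) is,
as in the one-level twin, (1.55) «D^{η*}_{U₀}D^η_{U₀}A = J» itself and is not restated; [4] (3.47)'s third entry `G′∇*` (source on sites) is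
the `p = 1` case of §2 on the scalar carrier and is not spelled out.  (iii) THE MAJORANTS ARE ARGUMENTS: conditional on inhabitants — for the
genuine `k`-level vector `G(1)` on the V1 torus r03's ROUTE V delivers (2.136)₁ (skeleton `B6Prop26KLevelSkeletonV1`, members pending:
`B6CubeWindowV1`, p38's partition files, p21's cover overlap), (2.136)₂,₄ are not begun; hence no `M_h ≥ 2`, `P′_μ ≥ 5`, «M large» or
weight-window hypothesis appears here, and the constants are EXISTENTIAL (functions of `d, ℓ, C, σ, n`), thresholds «RM sufficiently large»
explicit and `n`-dependent.  (iv) Levels `1 … k` with `Ω₁ = T_η`, lattice units `η = 1`, `x ∈ Ω_j` read at the object's own level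
`(blk x).1.1` (for bonds: the level of the initial point, r03's `blkV1`); real scalar fibre (𝔤-valued = componentwise).  (v) The general
statements at a regular background `U₀ ∈ 𝔄_k` ([4] Thm 3.3, rows B9.Thm3.3 / B8.Eq1.59 heads, typed leaves `B9.Thm33Printed`,
`B8FromB9.b8_159_transfer`) are NOT touched; row B8.Eq1.59's head does not move (owner's standing word).  NOT summit progress, NOT
continuum, NOT Clay.

RELATED IN THE TREE, NOT DUPLICATED (stem check 2026-08-23T04:30Z: `ls Balaban1983to89 | grep -i '159\|347'` = `B8Ineq159FlatTorus`
(the ONE-LEVEL hypothesis-free twin from [B5] (1.115), r05 g15/g18), `B9Ineq347`, `B9Ineq347AllEntries`, `B9Ineq347GpExt` (r06: function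
level / general background letters), `B2Ineq347*` (another paper); no multi-level instance): `B8Ineq198MultiLevelTorusL0.apply_le_of_invPowT`
(the SITE-carrier special case of §1, not modified), `B8ScaledSupNorm.*`, `B6GlobalChartV1.*`, `B6RandomWalk.HasMajorant` (USED BY NAME).
-/

namespace Literature.MathematicalPhysics.QuantumFieldTheory.Balaban1983to89.B8Ineq159MultiLevelTorusL0

open Finset
open B4Reflection242 (boxDom)
open B6MultiLevelBoxOperator hiding Domains mlOp_apply
open B6MultiLevelBoxOperatorL0
open B6MultiLevelTorusOperator hiding TDomains mlOpT_apply mlOpT_eq_reindex_chart mlOpT_mul_reindex mlOpT_tshift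
open B6MultiLevelTorusOperatorL0
open B6Geom246MultiLevelBox hiding Touch blkOf blkOf_corner blkOf_eq_iff_blk blkOf_eq_of_blk_i_eq blkOf_val bond bond_adj bset cen connected coord_bounds corner corner_mem csys dist_blkOf_le_box dist_blkOf_le_coord dist_blkOf_le_line dist_cen_le_of_adj dist_cen_le_of_touch dist_le_one_of_near dist_toR_cen_le exists_blkOf_eq geom lemma21_box lev_corner lev_eq_of_blkOf_eq levelGap pack reachable_blkOf reachable_of_near realizes scale_bounds touch_symm triangle_refl_nonneg walk_disp
open B6Geom246MultiLevelBoxL0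
open B6Geom246MultiLevelTorus hiding TouchT blkHom blkMap blkMap_blkOf blkMap_injective blkMap_surjective blkOf_tshift_eq bondT bondT_adj bond_le_bondT connectedT csysT distT_le_dist_box distT_le_dist_chart dist_posT_le_of_adj dist_posT_le_of_touchT dist_site_posT_le geomT label_bounds lemma21_torus levelGapT packT posT realizesT touchT_symm triangle_refl_nonneg_T walk_dispT
open B6Geom246MultiLevelTorusL0
open B6RandomWalk (HasMajorant BlockSupp hasMajorant_mono)
open B6Ineq261LevelGap (K261 K261_nonneg)
open B8Ineq192MultiLevelBox (abs_apply_le_of_levelBound levelRowSum_le)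
open B8Ineq192MultiLevelTorusL0
open B8Ineq198MultiLevelTorusL0 (rowSum_and_thresholdT)
open B6GlobalChartV1 (PV toBox)
open B6GlobalChartV1L0 (blkV1)
open Literature.MathematicalPhysics.QuantumFieldTheory.Balaban1983to89.B8Ineq159MultiLevelTorus (eq158_line2_V1)

noncomputable section

variable {d : ℕ}

/-! ## §1  Engine on an arbitrary carrier: a block majorant applied to a `(Lʲ)⁻ⁿ`-weighted input -/

section Engine

variable {ℓ Mh k R : ℕ} {P : Fin (d + 1) → ℕ} {D : TDomains d ℓ Mh k P R} {X : Type}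

/-- **A BLOCK MAJORANT APPLIED TO A `(Lʲ)⁻ⁿ`-WEIGHTED INPUT, ON ANY CARRIER** ([4] p. 398: «Using Lemma 2.1 in [4] we may replace the
factor (Lʲη)^α by (Lʲη)^β(L^{j′}η)^γ with β + γ = α»): for a carrier `X` with block map `blk : X → 𝔅`, if `T` has the majorant
`C·p(y)·e^{−σd_T(y,y′)}` (`C, p ≥ 0`), the input satisfies `|u(z)| ≦ A·(L^{j(z)})⁻ⁿ`, the row sums at the rate `τ` are `≦ c`, `τ + β ≦ σ`,
`β ≥ 0` and `Lⁿ ≦ e^{β(RM−1)}` ((2.60) threshold), then `|(Tu)(x)| ≦ A·C·p(y(x))·(Lⁿc)·(L^{j(x)})⁻ⁿ` — the carrier-generic twin of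
`B8Ineq198MultiLevelTorusL0.apply_le_of_invPowT` (sites), same proof.
[cite: Balaban1985BackgroundPropagators, (3.47) p.398, (3.41) p.397; Balaban1985RegularSpaces, (1.59) p.86; Balaban1984PropagatorsII, Lemma 2.1 (2.60)–(2.61) p.234, (2.52)–(2.55) p.232] -/
theorem apply_le_of_invPow_blk (hMh : 1 ≤ Mh) (hP : ∀ μ, 1 ≤ P μ) (hRM : 1 ≤ R * ((ℓ + 1) * Mh))
    (blk : X → ↥(B6Geom246MultiLevelBoxL0.bset D.toDomains)) {T : Module.End ℝ (X → ℝ)} {C σ β τ c : ℝ} (hC : 0 ≤ C) (hβ : 0 ≤ β) (hτβ : τ + β ≤ σ)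
    {pf : ↥(bset D.toDomains) → ℝ} (hpf : ∀ y, 0 ≤ pf y)
    (hT : HasMajorant (g := geomT D) blk T (fun y y' => C * pf y * Real.exp (-(σ * (geomT D).dist y y'))))
    (h261 : ∀ y : (geomT D).Site, ∑ y'' : (geomT D).Site, Real.exp (-(τ * (geomT D).dist y y'')) ≤ c)
    (n : ℕ) (hthr : ((ℓ : ℝ) + 1) ^ n ≤ Real.exp (β * ((geomTB D).R * (geomTB D).M)))
    {u : X → ℝ} {A : ℝ} (hA : 0 ≤ A)
    (hu : ∀ z, |u z| ≤ A * ((geomT D).len (blk z) ^ n)⁻¹) (x : X) :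
    |T u x| ≤ A * C * pf (blk x) * (((ℓ : ℝ) + 1) ^ n * c) * ((geomT D).len (blk x) ^ n)⁻¹ := by
  have hdnn := (triangle_refl_nonneg_T D hMh hP).2.2
  have hlen0 : ∀ y : ↥(bset D.toDomains), 0 ≤ (geomT D).len y := fun y => (lenT_pos D y).le
  have h1 := abs_apply_le_of_levelBound (g := geomT D) blk hT (p := fun b => ((geomT D).len b ^ n)⁻¹) hA
    (fun b => inv_nonneg.2 (pow_nonneg (hlen0 b) n)) hu x
  have hf : ∀ y y'' : (geomT D).Site, ((geomT D).len y'' ^ n)⁻¹ ≤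
      ((ℓ : ℝ) + 1) ^ n * Real.exp (β * (geomT D).dist y y'') * ((geomT D).len y ^ n)⁻¹ :=
    fun y y'' => inv_pow_lenT_le hMh hP hRM n hβ hthr y y''
  have h2 := levelRowSum_le (g := geomT D) hdnn (σ := σ) (β := β) (τ := τ) (A := ((ℓ : ℝ) + 1) ^ n) (c := c)
    hτβ (by positivity) (f := fun b => ((geomT D).len b ^ n)⁻¹) (fun b => inv_nonneg.2 (pow_nonneg (hlen0 b) n))
    hf h261 (blk x)
  refine h1.trans ?_
  have hsum : ∑ b' : (geomT D).Site, C * pf (blk x) * Real.exp (-(σ * (geomT D).dist (blk x) b')) *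
        ((geomT D).len b' ^ n)⁻¹ = C * pf (blk x) * ∑ b' : (geomT D).Site,
          Real.exp (-(σ * (geomT D).dist (blk x) b')) * ((geomT D).len b' ^ n)⁻¹ := by
    rw [Finset.mul_sum]
    exact Finset.sum_congr rfl fun b' _ => by ring
  rw [hsum]
  have hCp : 0 ≤ C * pf (blk x) := mul_nonneg hC (hpf _)
  calc A * (C * pf (blk x) * ∑ b' : (geomT D).Site,
          Real.exp (-(σ * (geomT D).dist (blk x) b')) * ((geomT D).len b' ^ n)⁻¹)
      ≤ A * (C * pf (blk x) * (((ℓ : ℝ) + 1) ^ n * c * ((geomT D).len (blk x) ^ n)⁻¹)) :=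
        mul_le_mul_of_nonneg_left (mul_le_mul_of_nonneg_left h2 hCp) hA
    _ = A * C * pf (blk x) * (((ℓ : ℝ) + 1) ^ n * c) * ((geomT D).len (blk x) ^ n)⁻¹ := by ring

end Engine

/-! ## §2  [4] (3.47) at `U = 1` from a (2.136)-shape majorant: «T : |·|₍₋ₙ₎ → |·|₍₋ₙ₊ₚ₎», constants before the torus -/

section Sup347

/-- **[4] (3.47) AT U = 1 ⇐ A [B6] (2.136)-SHAPE MAJORANT, BY LEMMA 2.1** ([4] p. 399 «This way the theorems are reduced to the
corresponding theorems for propagators without external gauge field»; p. 398 «Using Lemma 2.1 … we may replace the factor (Lʲη)^α by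
(Lʲη)^β(L^{j′}η)^γ»; B8 Prop. 3 «B₀ … are the corresponding norms of the operators … and depend on d and L only»): for all `C, σ > 0` and
every weight exponent `n` there are `B₀ > 0`, `N₁ ≥ 1` (functions of `d, ℓ, C, σ, n` ONLY) such that for every number of levels `k`, every
`M_h ≥ 1`, every `R` with `R·L·M_h ≥ N₁ + 1` («RM sufficiently large»), every torus size `P`, every nested torus family `D` with (2.1)–(2.2)
(`Ω₁ = T_η`), EVERY prefactor exponent `p`, EVERY carrier `X` with block map `blk : X → 𝔅`, EVERY operator `T` on `X → ℝ` with
«|(Tμ)(x)| ≦ C(Lʲ)^p e^{−σd(y,y′)}|μ| for x ∈ Δ(y), supp μ ⊂ Δ(y′)» (`HasMajorant`) and every function `u` with `|u(z)| ≦ S·(L^{j(z)})⁻ⁿ`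
(«|u|₍₋ₙ₎ ≦ S»): `|(Tu)(x)| ≦ B₀·(L^{j(x)})^p·(L^{j(x)})⁻ⁿ·S` at every `x` («|Tu|₍₋ₙ₊ₚ₎ ≦ B₀|u|₍₋ₙ₎»).
[cite: Balaban1985BackgroundPropagators, (3.47) p.398, Theorem 3.3 p.399, (3.41) p.397; Balaban1985RegularSpaces, (1.59) p.86, Prop. 3 p.87; Balaban1984PropagatorsII, Prop. 2.6 (2.136) p.247, Lemma 2.1 (2.60)–(2.61) p.234, (2.52)–(2.55) p.232, p.224 (Ω₁ = T_η admitted)] -/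
theorem sup347_of_majorant (d ℓ : ℕ) {C σ : ℝ} (hC : 0 < C) (hσ : 0 < σ) (n : ℕ) :
    ∃ B₀ : ℝ, ∃ N₁ : ℕ, 0 < B₀ ∧ 0 < N₁ ∧
      ∀ (k Mh R : ℕ), 1 ≤ Mh → N₁ + 1 ≤ R * ((ℓ + 1) * Mh) →
      ∀ (P : Fin (d + 1) → ℕ) (_hP : ∀ μ, 1 ≤ P μ) (D : B6MultiLevelTorusOperatorL0.TDomains d ℓ Mh k P R) (p : ℕ)
        (X : Type) (blk : X → ↥(bset D.toDomains)) (T : Module.End ℝ (X → ℝ)),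
        HasMajorant (g := geomT D) blk T
          (fun y y' => C * (geomT D).len y ^ p * Real.exp (-(σ * (geomT D).dist y y'))) →
        ∀ (u : X → ℝ) (S : ℝ), 0 ≤ S → (∀ z, |u z| ≤ S * ((geomT D).len (blk z) ^ n)⁻¹) →
          ∀ x : X, |T u x| ≤ B₀ * (geomT D).len (blk x) ^ p * ((geomT D).len (blk x) ^ n)⁻¹ * S := by
  have hL0 : (0 : ℝ) < (ℓ : ℝ) + 1 := by positivity
  -- Lemma 2.1 / absorption at the rate `σ/2` (majorant rate `σ = σ/2 + σ/2`)
  obtain ⟨τ, hτ⟩ : ∃ τ : ℝ, τ = σ / 2 := ⟨_, rfl⟩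
  have hτ0 : 0 < τ := by rw [hτ]; positivity
  obtain ⟨N₁, hN₁⟩ : ∃ N₁ : ℕ, N₁ = ⌈(2 * ((d : ℝ) + 1) + n + 1) * ((ℓ : ℝ) + 1) / τ⌉₊ + 1 := ⟨_, rfl⟩
  have hN₁pos : 0 < N₁ := by rw [hN₁]; omega
  obtain ⟨cK, hcK⟩ : ∃ cK : ℝ, cK = K261 N₁ (d + 1) ((ℓ : ℝ) + 1) 1 (1 * τ) := ⟨_, rfl⟩
  have hcK0 : 0 ≤ cK := by rw [hcK]; exact K261_nonneg hL0.le zero_le_one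
  obtain ⟨Cp, hCp⟩ : ∃ Cp : ℝ, Cp = C * (((ℓ : ℝ) + 1) ^ n * cK) := ⟨_, rfl⟩
  have hCp0 : 0 ≤ Cp := by rw [hCp]; positivity
  refine ⟨Cp + 1, N₁, by linarith, hN₁pos, ?_⟩
  intro k Mh R hMh1 hRM1 P hP D p X blk T hT u S hS hu x
  have hRMone : 1 ≤ R * ((ℓ + 1) * Mh) := le_trans (by omega) hRM1
  obtain ⟨hrow, hthr⟩ := rowSum_and_thresholdT (D := D) hMh1 hP hτ0 n hN₁ hRM1
  rw [← hcK] at hrow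
  have hlen0 : ∀ y : ↥(bset D.toDomains), 0 ≤ (geomT D).len y := fun y => (lenT_pos D y).le
  have hrate : τ + τ ≤ σ := by rw [hτ]; linarith
  have h := apply_le_of_invPow_blk (D := D) hMh1 hP hRMone blk (σ := σ) (β := τ) (τ := τ) (c := cK) hC.le hτ0.le
    hrate (pf := fun y => (geomT D).len y ^ p) (fun y => pow_nonneg (hlen0 y) p) hT (hrow τ le_rfl) n hthr hS hu x
  refine h.trans ?_
  show S * C * (geomT D).len (blk x) ^ p * (((ℓ : ℝ) + 1) ^ n * cK) * ((geomT D).len (blk x) ^ n)⁻¹ ≤ _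
  have hq : 0 ≤ (geomT D).len (blk x) ^ p * (((geomT D).len (blk x) ^ n)⁻¹ * S) :=
    mul_nonneg (pow_nonneg (hlen0 _) p) (mul_nonneg (inv_nonneg.2 (pow_nonneg (hlen0 _) n)) hS)
  have heq : S * C * (geomT D).len (blk x) ^ p * (((ℓ : ℝ) + 1) ^ n * cK) * ((geomT D).len (blk x) ^ n)⁻¹ =
      Cp * ((geomT D).len (blk x) ^ p * (((geomT D).len (blk x) ^ n)⁻¹ * S)) := by rw [hCp]; ring
  rw [heq]
  calc Cp * ((geomT D).len (blk x) ^ p * (((geomT D).len (blk x) ^ n)⁻¹ * S))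
      ≤ (Cp + 1) * ((geomT D).len (blk x) ^ p * (((geomT D).len (blk x) ^ n)⁻¹ * S)) :=
        mul_le_mul_of_nonneg_right (by linarith) hq
    _ = (Cp + 1) * (geomT D).len (blk x) ^ p * ((geomT D).len (blk x) ^ n)⁻¹ * S := by ring

end Sup347

/-! ## §3  (1.59), the three propagator members in operator form, at U₀ = 1 on the `k`-level V1 torus (vector fields = fine bond functions) -/

section V1

variable {ℓ : ℕ} {m K : ℕ} {hd : 1 ≤ d + 1} {hL : Odd (ℓ + 1) ∧ 1 < ℓ + 1}

/-- **THE SCALE OF A BOND**: on r03's V1 torus the block of a fine bond `b` in p21's `𝔅` is the block of its initial point, so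
`Lʲ` at `b` is `L^{j(b₋)}`, `j(b₋) = D.lev` of the chart point (dictionary `blkV1`/`toBox`/`lenT_blkOf`).
[cite: Balaban1984PropagatorsII, (2.45)–(2.46) p.231 («d(x, x′) = d(y, y′) if x ∈ B^j(y)»); Balaban1985RegularSpaces, p.86 (definition after (1.55)), dictionary] -/
theorem len_blkV1 {Mh k R : ℕ} {P' : Fin (d + 1) → ℕ} (hN : ∀ μ, N0 ℓ Mh k P' μ = (PV d ℓ m K hd hL).sitesPerDir 0)
    (D : B6MultiLevelTorusOperatorL0.TDomains d ℓ Mh k P' R) (b : PBond (PV d ℓ m K hd hL) 0) :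
    (geomT D).len (blkV1 hN D b) = ((ℓ : ℝ) + 1) ^ D.lev (toBox hN b.src).1 := by
  unfold blkV1
  exact lenT_blkOf D _

/-- **(1.59) AT U₀ = 1 ON THE `k`-LEVEL TORUS, VECTOR SIDE — THE THREE PROPAGATOR MEMBERS IN OPERATOR FORM, THE PROP.-2.6 MAJORANTS AS
ARGUMENTS** («Theorem 3.3 of [4] implies the bounds |A|₍₋₁₎, |∇^η_{U₀}A|₍₋₂₎, …, |Δ^η_{U₀}A|₍₋₃₎ ≦ B₀(|J|₍₋₃₎ + |B₁|)», here for the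
operator part «G(U₀)X, ∇_{U₀}G(U₀)X, Δ_{U₀}G(U₀)X against |X|₍₋ₙ₎», every `n`): for all `C, σ > 0` and `n` there are `B₀ > 0`, `N₁ ≥ 1`
(functions of `d, ℓ, C, σ, n`) such that for every `k`, `M_h ≥ 1`, `R·L·M_h ≥ N₁ + 1`, `P′_μ ≥ 1`, every torus family `D`, every V1 volume
(`m, K` with `hN` : the fundamental box is the torus) and EVERY operators `Gv`, `DGv ν` (`ν : Fin (d+1)`), `LGv` on the vector fields
`PBond (PV d ℓ m K hd hL) 0 → ℝ` with the (2.136) majorants on `blkV1 hN D` — prefactors `(Lʲ)²` («|(GJ)(x)|»), `Lʲ` («|(∇GJ)(x)|», each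
component), `1` («|(ΔGJ)(x)|») —, every vector field `X` with `|X(b)| ≦ S·(L^{j(b)})⁻ⁿ` and every bond `b` (`j` its level):
`|(Gv X)(b)| ≦ B₀(Lʲ)²(Lʲ)⁻ⁿS`, `|(DGv ν X)(b)| ≦ B₀Lʲ(Lʲ)⁻ⁿS`, `|(LGv X)(b)| ≦ B₀(Lʲ)⁻ⁿS`.  For the genuine `G(1) = Δ_a⁻¹` of (1.58)/(2.19)
take `Gv := onFun (GE (domT hN D hk) hcf hw)` (r03), `DGv ν := ∇_ν ∘ Gv`, `LGv := Δ ∘ Gv` once ROUTE V inhabits the hypotheses.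
[cite: Balaban1985RegularSpaces, (1.59) p.86, (1.58) p.86, Prop. 3 p.87; Balaban1985BackgroundPropagators, Theorem 3.3 p.399, (3.47) p.398; Balaban1984PropagatorsII, Prop. 2.6 (2.136) p.247, (2.19) p.226, Lemma 2.1 (2.60)–(2.61) p.234] -/
theorem ineq159_multiLevelTorus_V1 (d ℓ : ℕ) {C σ : ℝ} (hC : 0 < C) (hσ : 0 < σ) (n : ℕ) :
    ∃ B₀ : ℝ, ∃ N₁ : ℕ, 0 < B₀ ∧ 0 < N₁ ∧
      ∀ (k Mh R : ℕ), 1 ≤ Mh → N₁ + 1 ≤ R * ((ℓ + 1) * Mh) →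
      ∀ (P' : Fin (d + 1) → ℕ) (_hP : ∀ μ, 1 ≤ P' μ) (D : B6MultiLevelTorusOperatorL0.TDomains d ℓ Mh k P' R)
        (m K : ℕ) (hd : 1 ≤ d + 1) (hL : Odd (ℓ + 1) ∧ 1 < ℓ + 1)
        (hN : ∀ μ, N0 ℓ Mh k P' μ = (PV d ℓ m K hd hL).sitesPerDir 0)
        (Gv LGv : Module.End ℝ (PBond (PV d ℓ m K hd hL) 0 → ℝ))
        (DGv : Fin (d + 1) → Module.End ℝ (PBond (PV d ℓ m K hd hL) 0 → ℝ)),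
        HasMajorant (g := geomT D) (blkV1 hN D) Gv
          (fun y y' => C * (geomT D).len y ^ 2 * Real.exp (-(σ * (geomT D).dist y y'))) →
        (∀ ν, HasMajorant (g := geomT D) (blkV1 hN D) (DGv ν)
          (fun y y' => C * (geomT D).len y * Real.exp (-(σ * (geomT D).dist y y')))) →
        HasMajorant (g := geomT D) (blkV1 hN D) LGv
          (fun y y' => C * Real.exp (-(σ * (geomT D).dist y y'))) →
        ∀ (Xv : PBond (PV d ℓ m K hd hL) 0 → ℝ) (S : ℝ), 0 ≤ S →
          (∀ b, |Xv b| ≤ S * ((geomT D).len (blkV1 hN D b) ^ n)⁻¹) →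
          ∀ b : PBond (PV d ℓ m K hd hL) 0,
            |Gv Xv b| ≤ B₀ * (geomT D).len (blkV1 hN D b) ^ 2 * ((geomT D).len (blkV1 hN D b) ^ n)⁻¹ * S ∧
            (∀ ν, |DGv ν Xv b| ≤ B₀ * (geomT D).len (blkV1 hN D b) * ((geomT D).len (blkV1 hN D b) ^ n)⁻¹ * S) ∧
            |LGv Xv b| ≤ B₀ * ((geomT D).len (blkV1 hN D b) ^ n)⁻¹ * S := by
  obtain ⟨B₀, N₁, hB₀, hN₁, h⟩ := sup347_of_majorant d ℓ hC hσ n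
  refine ⟨B₀, N₁, hB₀, hN₁, ?_⟩
  intro k Mh R hMh1 hRM1 P' hP D m K hd hL hN Gv LGv DGv hG hD hLap Xv S hS hX b
  have key := h k Mh R hMh1 hRM1 P' hP D
  refine ⟨?_, fun ν => ?_, ?_⟩
  · exact key 2 _ (blkV1 hN D) Gv hG Xv S hS hX b
  · have hD' : HasMajorant (g := geomT D) (blkV1 hN D) (DGv ν)
        (fun y y' => C * (geomT D).len y ^ 1 * Real.exp (-(σ * (geomT D).dist y y'))) :=
      hasMajorant_mono (g := geomT D) (blkV1 hN D) (hD ν) fun y y' => le_of_eq (by rw [pow_one])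
    have h1 := key 1 _ (blkV1 hN D) (DGv ν) hD' Xv S hS hX b
    rw [pow_one] at h1
    exact h1
  · have hL' : HasMajorant (g := geomT D) (blkV1 hN D) LGv
        (fun y y' => C * (geomT D).len y ^ 0 * Real.exp (-(σ * (geomT D).dist y y'))) :=
      hasMajorant_mono (g := geomT D) (blkV1 hN D) hLap fun y y' => le_of_eq (by rw [pow_zero, mul_one])
    have h0 := key 0 _ (blkV1 hN D) LGv hL' Xv S hS hX b
    rw [pow_zero, mul_one] at h0
    exact h0

/-- **(1.59) WITH THE PRINTED EXPONENTS (`n = 3`): «|G(U₀)X|₍₋₁₎, |∇_{U₀}G(U₀)X|₍₋₂₎, |Δ_{U₀}G(U₀)X|₍₋₃₎ ≦ B₀|X|₍₋₃₎» AT U₀ = 1 ON THE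
`k`-LEVEL V1 TORUS**, pointwise: under the hypotheses of `ineq159_multiLevelTorus_V1` with `n = 3`, for `|X(b)| ≦ S·(L^{j(b)})⁻³`:
`|(Gv X)(b)| ≦ B₀S(Lʲ)⁻¹`, `|(DGv ν X)(b)| ≦ B₀S(Lʲ)⁻²`, `|(LGv X)(b)| ≦ B₀S(Lʲ)⁻³` (`j` the level of `b`).
[cite: Balaban1985RegularSpaces, (1.59) p.86; Balaban1985BackgroundPropagators, (3.47) p.398 (γ = −3), Theorem 3.3 p.399; Balaban1984PropagatorsII, Prop. 2.6 (2.136) p.247] -/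
theorem ineq159_multiLevelTorus_V1_three (d ℓ : ℕ) {C σ : ℝ} (hC : 0 < C) (hσ : 0 < σ) :
    ∃ B₀ : ℝ, ∃ N₁ : ℕ, 0 < B₀ ∧ 0 < N₁ ∧
      ∀ (k Mh R : ℕ), 1 ≤ Mh → N₁ + 1 ≤ R * ((ℓ + 1) * Mh) →
      ∀ (P' : Fin (d + 1) → ℕ) (_hP : ∀ μ, 1 ≤ P' μ) (D : B6MultiLevelTorusOperatorL0.TDomains d ℓ Mh k P' R)
        (m K : ℕ) (hd : 1 ≤ d + 1) (hL : Odd (ℓ + 1) ∧ 1 < ℓ + 1)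
        (hN : ∀ μ, N0 ℓ Mh k P' μ = (PV d ℓ m K hd hL).sitesPerDir 0)
        (Gv LGv : Module.End ℝ (PBond (PV d ℓ m K hd hL) 0 → ℝ))
        (DGv : Fin (d + 1) → Module.End ℝ (PBond (PV d ℓ m K hd hL) 0 → ℝ)),
        HasMajorant (g := geomT D) (blkV1 hN D) Gv
          (fun y y' => C * (geomT D).len y ^ 2 * Real.exp (-(σ * (geomT D).dist y y'))) →
        (∀ ν, HasMajorant (g := geomT D) (blkV1 hN D) (DGv ν)
          (fun y y' => C * (geomT D).len y * Real.exp (-(σ * (geomT D).dist y y')))) →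
        HasMajorant (g := geomT D) (blkV1 hN D) LGv
          (fun y y' => C * Real.exp (-(σ * (geomT D).dist y y'))) →
        ∀ (Xv : PBond (PV d ℓ m K hd hL) 0 → ℝ) (S : ℝ), 0 ≤ S →
          (∀ b, |Xv b| ≤ S * ((geomT D).len (blkV1 hN D b) ^ 3)⁻¹) →
          ∀ b : PBond (PV d ℓ m K hd hL) 0,
            |Gv Xv b| ≤ B₀ * S * ((geomT D).len (blkV1 hN D b))⁻¹ ∧
            (∀ ν, |DGv ν Xv b| ≤ B₀ * S * ((geomT D).len (blkV1 hN D b) ^ 2)⁻¹) ∧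
            |LGv Xv b| ≤ B₀ * S * ((geomT D).len (blkV1 hN D b) ^ 3)⁻¹ := by
  obtain ⟨B₀, N₁, hB₀, hN₁, h⟩ := ineq159_multiLevelTorus_V1 d ℓ hC hσ 3
  refine ⟨B₀, N₁, hB₀, hN₁, ?_⟩
  intro k Mh R hMh1 hRM1 P' hP D m K hd hL hN Gv LGv DGv hG hD hLap Xv S hS hX b
  obtain ⟨h2, h1, h0⟩ := h k Mh R hMh1 hRM1 P' hP D m K hd hL hN Gv LGv DGv hG hD hLap Xv S hS hX b
  have hlpos : 0 < (geomT D).len (blkV1 hN D b) := lenT_pos D _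
  have hl0 : (geomT D).len (blkV1 hN D b) ≠ 0 := hlpos.ne'
  refine ⟨h2.trans (le_of_eq ?_), fun ν => (h1 ν).trans (le_of_eq ?_), h0.trans (le_of_eq (by ring))⟩
  · field_simp
  · field_simp

end V1

/-! ## §4  In print's own norm `|·|₍α₎` of p. 86 (`B8ScaledSupNorm.msup`): the dictionary on an arbitrary finite carrier, (1.59) restated -/

section MSup

open B8ScaledSupNorm (msup weight Bdd msup_le_of_pointwise norm_le_of_msup_le msup_nonneg)

variable {ℓ Mh k R : ℕ} {P : Fin (d + 1) → ℕ} (D : TDomains d ℓ Mh k P R) {X : Type} [Fintype X]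
  (blk : X → ↥(bset D.toDomains))

/-- the cast of the block side `L = ℓ + 1`. [folklore] -/
private theorem castL (ℓ : ℕ) : (((ℓ + 1 : ℕ) : ℝ)) = (ℓ : ℝ) + 1 := by push_cast; ring

/-- the p. 86 scale factor at `α = −n`, `η = 1`: `((Lʲ·1))^{−n} = ((Lʲ)ⁿ)⁻¹`. [cite: Balaban1985RegularSpaces, p.86 (definition after (1.55))] -/
private theorem scale_rpow_neg (ℓ j n : ℕ) :
    ((((ℓ + 1 : ℕ) : ℝ)) ^ j * (1 : ℝ)) ^ (-(n : ℝ)) = ((((ℓ : ℝ) + 1) ^ j) ^ n)⁻¹ := by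
  rw [mul_one, castL, Real.rpow_neg (pow_nonneg (by positivity) j), Real.rpow_natCast]

/-- **THE p. 86 NORM ON A FINITE CARRIER IS FINITE**: the weighted family `(Lʲ)ⁿ‖u(z)‖`, `j ≤ k`, is bounded — the side condition `Bdd` of
the typed `sup_j sup_{Ω_j}` (twin of `B8Ineq198MultiLevelBoxL0.bdd_box`, block map instead of the site level).
[cite: Balaban1985RegularSpaces, p.86 (definition after (1.55))] -/
theorem bdd_blk (n : ℕ) (u : X → ℝ) :
    Bdd (ℓ + 1) k 1 (-(n : ℝ)) (fun j (z : X) => j ≤ (blk z : ↥(B6Geom246MultiLevelBoxL0.bset D.toDomains)).1.1) u := by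
  classical
  refine ⟨∑ z : X, ∑ j ∈ Finset.range (k + 1), weight (ℓ + 1) 1 (-(n : ℝ)) j * ‖u z‖, fun j hj z _ => ?_⟩
  have hw : ∀ j' z', 0 ≤ weight (ℓ + 1) 1 (-(n : ℝ)) j' * ‖u z'‖ := fun j' z' =>
    mul_nonneg (B8ScaledSupNorm.weight_nonneg _ zero_le_one _ _) (norm_nonneg _)
  calc weight (ℓ + 1) 1 (-(n : ℝ)) j * ‖u z‖
      ≤ ∑ j' ∈ Finset.range (k + 1), weight (ℓ + 1) 1 (-(n : ℝ)) j' * ‖u z‖ :=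
        Finset.single_le_sum (f := fun j' => weight (ℓ + 1) 1 (-(n : ℝ)) j' * ‖u z‖) (fun j' _ => hw j' z)
          (Finset.mem_range.2 (Nat.lt_succ_of_le hj))
    _ ≤ ∑ z' : X, ∑ j' ∈ Finset.range (k + 1), weight (ℓ + 1) 1 (-(n : ℝ)) j' * ‖u z'‖ :=
        Finset.single_le_sum (f := fun z' => ∑ j' ∈ Finset.range (k + 1), weight (ℓ + 1) 1 (-(n : ℝ)) j' * ‖u z'‖)
          (fun z' _ => Finset.sum_nonneg fun j' _ => hw j' z') (Finset.mem_univ z)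

/-- **DICTIONARY, NORM ⇒ POINTWISE** on a finite carrier with block map `blk` (`Ω_j = {z : j ≤ level of z}`, levels `1 … k`, `η = 1`):
`|u|₍₋ₙ₎ ≦ S` gives `|u(z)| ≦ S·(L^{j(z)})⁻ⁿ` at every object read at its own level ([4] p. 397 «For α negative we can take Ω_j instead of
Ω_j∖Ω_{j+1}»). [cite: Balaban1985RegularSpaces, p.86 (definition after (1.55)); Balaban1985BackgroundPropagators, (3.41) p.397] -/
theorem pointwise_of_msup_le_blk (n : ℕ) {u : X → ℝ} {S : ℝ}
    (h : msup (ℓ + 1) k 1 (-(n : ℝ)) (fun j (z : X) => j ≤ (blk z).1.1) u ≤ S) (z : X) :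
    |u z| ≤ S * ((B6Geom246MultiLevelTorusL0.geomT D).len (blk z) ^ n)⁻¹ := by
  have h1 := norm_le_of_msup_le (E := ℝ) (by omega : 1 ≤ ℓ + 1) one_pos (bdd_blk D blk n u) h
    (scale_bounds D.toDomains (blk z)).2 (i := z) le_rfl
  rw [Real.norm_eq_abs, scale_rpow_neg] at h1
  rw [lenT_eq]
  exact h1

omit [Fintype X] in
/-- **DICTIONARY, POINTWISE ⇒ NORM**: `|u(z)| ≦ S·(L^{j(z)})⁻ⁿ` at every object (`S ≥ 0`) gives `|u|₍₋ₙ₎ ≦ S` (on `Ω_j ∋ z` one has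
`j ≤ j(z)`, so `(L^{j(z)})⁻ⁿ ≦ (Lʲ)⁻ⁿ`; no finiteness needed). [cite: Balaban1985RegularSpaces, p.86 (definition after (1.55)); Balaban1985BackgroundPropagators, (3.41) p.397] -/
theorem msup_le_of_pointwise_blk (n : ℕ) {u : X → ℝ} {S : ℝ} (hS : 0 ≤ S)
    (h : ∀ z : X, |u z| ≤ S * ((B6Geom246MultiLevelTorusL0.geomT D).len (blk z) ^ n)⁻¹) :
    msup (ℓ + 1) k 1 (-(n : ℝ)) (fun j (z : X) => j ≤ (blk z).1.1) u ≤ S := by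
  refine msup_le_of_pointwise (E := ℝ) (by omega : 1 ≤ ℓ + 1) one_pos hS fun j _ z hjz => ?_
  rw [Real.norm_eq_abs, scale_rpow_neg]
  have hL1 : (1 : ℝ) ≤ (ℓ : ℝ) + 1 := by linarith [(Nat.cast_nonneg ℓ : (0 : ℝ) ≤ ℓ)]
  have hj : (((ℓ : ℝ) + 1) ^ j) ^ n ≤ (((ℓ : ℝ) + 1) ^ (blk z).1.1) ^ n :=
    pow_le_pow_left₀ (by positivity) (pow_le_pow_right₀ hL1 hjz) n
  have hjpos : 0 < (((ℓ : ℝ) + 1) ^ j) ^ n := by positivity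
  have hz := h z
  rw [lenT_eq] at hz
  exact hz.trans (mul_le_mul_of_nonneg_left ((inv_le_inv₀ (by positivity) hjpos).2 hj) hS)

end MSup

section MSupV1

open B8ScaledSupNorm (msup msup_nonneg)

/-- **(1.59) IN PRINT'S OWN NORM, AT U₀ = 1 ON THE `k`-LEVEL V1 TORUS — «|G(U₀)X|₍₋₁₎, |∇_{U₀}G(U₀)X|₍₋₂₎, |Δ_{U₀}G(U₀)X|₍₋₃₎ ≦
B₀|X|₍₋₃₎»** with `|·|₍α₎ = B8ScaledSupNorm.msup (ℓ+1) k 1 α (Ω_j := {b : j ≤ level of b})` on the vector fields (fine bond functions), the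
three Prop.-2.6 majorants of `Gv`, `DGv ν`, `LGv` as hypotheses: for every vector field `X`,
`|Gv X|₍₋₁₎ ≦ B₀|X|₍₋₃₎`, `|DGv ν X|₍₋₂₎ ≦ B₀|X|₍₋₃₎` (every `ν`), `|LGv X|₍₋₃₎ ≦ B₀|X|₍₋₃₎` — the printed shape symbol for symbol.
[cite: Balaban1985RegularSpaces, (1.59) p.86, p.86 (definition after (1.55)), Prop. 3 p.87; Balaban1985BackgroundPropagators, (3.47) p.398, (3.41) p.397, Theorem 3.3 p.399; Balaban1984PropagatorsII, Prop. 2.6 (2.136) p.247] -/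
theorem ineq159_multiLevelTorus_V1_msup (d ℓ : ℕ) {C σ : ℝ} (hC : 0 < C) (hσ : 0 < σ) :
    ∃ B₀ : ℝ, ∃ N₁ : ℕ, 0 < B₀ ∧ 0 < N₁ ∧
      ∀ (k Mh R : ℕ), 1 ≤ Mh → N₁ + 1 ≤ R * ((ℓ + 1) * Mh) →
      ∀ (P' : Fin (d + 1) → ℕ) (_hP : ∀ μ, 1 ≤ P' μ) (D : B6MultiLevelTorusOperatorL0.TDomains d ℓ Mh k P' R)
        (m K : ℕ) (hd : 1 ≤ d + 1) (hL : Odd (ℓ + 1) ∧ 1 < ℓ + 1)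
        (hN : ∀ μ, N0 ℓ Mh k P' μ = (PV d ℓ m K hd hL).sitesPerDir 0)
        (Gv LGv : Module.End ℝ (PBond (PV d ℓ m K hd hL) 0 → ℝ))
        (DGv : Fin (d + 1) → Module.End ℝ (PBond (PV d ℓ m K hd hL) 0 → ℝ)),
        HasMajorant (g := geomT D) (blkV1 hN D) Gv
          (fun y y' => C * (geomT D).len y ^ 2 * Real.exp (-(σ * (geomT D).dist y y'))) →
        (∀ ν, HasMajorant (g := geomT D) (blkV1 hN D) (DGv ν)
          (fun y y' => C * (geomT D).len y * Real.exp (-(σ * (geomT D).dist y y')))) →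
        HasMajorant (g := geomT D) (blkV1 hN D) LGv
          (fun y y' => C * Real.exp (-(σ * (geomT D).dist y y'))) →
        ∀ Xv : PBond (PV d ℓ m K hd hL) 0 → ℝ,
          msup (ℓ + 1) k 1 (-1) (fun j (b : PBond (PV d ℓ m K hd hL) 0) => j ≤ (blkV1 hN D b).1.1) (Gv Xv) ≤
            B₀ * msup (ℓ + 1) k 1 (-3) (fun j (b : PBond (PV d ℓ m K hd hL) 0) => j ≤ (blkV1 hN D b).1.1) Xv ∧
          (∀ ν, msup (ℓ + 1) k 1 (-2) (fun j (b : PBond (PV d ℓ m K hd hL) 0) => j ≤ (blkV1 hN D b).1.1) (DGv ν Xv) ≤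
            B₀ * msup (ℓ + 1) k 1 (-3) (fun j (b : PBond (PV d ℓ m K hd hL) 0) => j ≤ (blkV1 hN D b).1.1) Xv) ∧
          msup (ℓ + 1) k 1 (-3) (fun j (b : PBond (PV d ℓ m K hd hL) 0) => j ≤ (blkV1 hN D b).1.1) (LGv Xv) ≤
            B₀ * msup (ℓ + 1) k 1 (-3) (fun j (b : PBond (PV d ℓ m K hd hL) 0) => j ≤ (blkV1 hN D b).1.1) Xv := by
  obtain ⟨B₀, N₁, hB₀, hN₁, h⟩ := ineq159_multiLevelTorus_V1_three d ℓ hC hσ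
  refine ⟨B₀, N₁, hB₀, hN₁, ?_⟩
  intro k Mh R hMh1 hRM1 P' hP D m K hd hL hN Gv LGv DGv hG hD hLap Xv
  set S : ℝ := msup (ℓ + 1) k 1 (-3) (fun j (b : PBond (PV d ℓ m K hd hL) 0) => j ≤ (blkV1 hN D b).1.1) Xv with hSdef
  have e3 : (-3 : ℝ) = -((3 : ℕ) : ℝ) := by norm_num
  have e2 : (-2 : ℝ) = -((2 : ℕ) : ℝ) := by norm_num
  have e1 : (-1 : ℝ) = -((1 : ℕ) : ℝ) := by norm_num
  have hS : 0 ≤ S := msup_nonneg _ _ zero_le_one _ _ _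
  have hX : ∀ b : PBond (PV d ℓ m K hd hL) 0, |Xv b| ≤ S * ((geomT D).len (blkV1 hN D b) ^ 3)⁻¹ := by
    have hle : msup (ℓ + 1) k 1 (-((3 : ℕ) : ℝ)) (fun j (b : PBond (PV d ℓ m K hd hL) 0) => j ≤ (blkV1 hN D b).1.1) Xv ≤ S := by
      rw [← e3]
    exact pointwise_of_msup_le_blk D (blkV1 hN D) 3 hle
  have hb := h k Mh R hMh1 hRM1 P' hP D m K hd hL hN Gv LGv DGv hG hD hLap Xv S hS hX
  have hBS : 0 ≤ B₀ * S := mul_nonneg hB₀.le hS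
  refine ⟨?_, fun ν => ?_, ?_⟩
  · rw [e1]
    refine msup_le_of_pointwise_blk D (blkV1 hN D) 1 hBS fun b => ?_
    rw [pow_one]
    exact (hb b).1
  · rw [e2]
    refine msup_le_of_pointwise_blk D (blkV1 hN D) 2 hBS fun b => ?_
    exact (hb b).2.1 ν
  · rw [e3]
    refine msup_le_of_pointwise_blk D (blkV1 hN D) 3 hBS fun b => ?_
    exact (hb b).2.2

end MSupV1

/-! ## §5  (1.57) ⟹ (1.58), line 2, for the genuine multi-level vector operator `Δ_a` of (2.19), and the `|A|₍₋₁₎` member of (1.59)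
for THE `k`-level `G(1) = Δ_a⁻¹` of the V1 torus modulo its (2.136)₁ majorant -/

section Eq158

open B6SectAOperatorsV1 (dE dsE dcE dcsE QE QsE aE RE BondIdx BondIdxSpace)
open B6SectAVectorModelV1 (deltaAE GE GE_deltaAE deltaAE_def)
open BalabanImbrieJaffe1984to88.BIJ85AxialPropagator411 (BondSpace)
open B6Ineq2133TwoScaleV1 (onFun onFun_apply)
open B6GlobalChartV1L0 (domT)

/-- **(1.58) ⟹ THE `|A|₍₋₁₎` MEMBER OF (1.59) FOR THE GENUINE `k`-LEVEL `G(1) = Δ_a⁻¹` OF THE V1 TORUS, MODULO ITS (2.136)₁ MAJORANT**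
(«Theorem 3.3 of [4] implies the bounds |A|₍₋₁₎ ≦ B₀(|J|₍₋₃₎ + |B₁|)», the operator step): for all `C, σ > 0`, `n` there are `B₀, N₁`
(functions of `d, ℓ, C, σ, n`) such that on every admissible torus datum, for r03's V1 reading `domT hN D hk` of p21's family `D`
(`B6GlobalChartV1`), every `c′ ≠ 0`, `w > 0`: IF `G(1) = onFun (GE (domT hN D hk) hc′ hw)` has the (2.136)₁ majorant `C(Lʲ)²e^{−σd_T}`
on `blkV1 hN D` (the conclusion shape of r03's `B6Prop26KLevelSkeletonV1L0.prop26_2136_kLevel_skeleton`, ROUTE V), THEN every `A` with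
(1.55) `∂*∂A = J`, (1.42) `R∂*A = 0`, (1.56) `QA = B` and `|(J + Q*aB)(b)| ≦ S·(L^{j(b)})⁻ⁿ` obeys `|A(b)| ≦ B₀(Lʲ)²(Lʲ)⁻ⁿS` at every bond
(`n = 3`: `|A|₍₋₁₎ ≦ B₀|J + Q*aB|₍₋₃₎`).
[cite: Balaban1985RegularSpaces, (1.58)–(1.59) p.86, Prop. 3 p.87; Balaban1985BackgroundPropagators, Theorem 3.3 p.399, (3.47) p.398; Balaban1984PropagatorsII, Prop. 2.6 (2.136) p.247, (2.19)/(2.22) p.226] -/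
theorem ineq159_A_member_V1 (d ℓ : ℕ) {C σ : ℝ} (hC : 0 < C) (hσ : 0 < σ) (n : ℕ) :
    ∃ B₀ : ℝ, ∃ N₁ : ℕ, 0 < B₀ ∧ 0 < N₁ ∧
      ∀ (k Mh R : ℕ), 1 ≤ Mh → N₁ + 1 ≤ R * ((ℓ + 1) * Mh) →
      ∀ (P' : Fin (d + 1) → ℕ) (_hP : ∀ μ, 1 ≤ P' μ) (D : B6MultiLevelTorusOperatorL0.TDomains d ℓ Mh k P' R)
        (m K : ℕ) (hd : 1 ≤ d + 1) (hL : Odd (ℓ + 1) ∧ 1 < ℓ + 1)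
        (hN : ∀ μ, N0 ℓ Mh k P' μ = (PV d ℓ m K hd hL).sitesPerDir 0) (hk : k ≤ m + K)
        (cf : ℝ) (hcf : cf ≠ 0) (w : BondIdx (domT hN D hk) → ℝ) (hw : ∀ i, 0 < w i),
        HasMajorant (g := geomT D) (blkV1 hN D) (onFun (GE (domT hN D hk) hcf hw))
          (fun y y' => C * (geomT D).len y ^ 2 * Real.exp (-(σ * (geomT D).dist y y'))) →
        ∀ (A J : BondSpace (PV d ℓ m K hd hL)) (B : BondIdxSpace (domT hN D hk)),
          dcsE cf (dcE cf A) = J → RE (domT hN D hk) cf (dsE cf A) = 0 → QE (domT hN D hk) A = B →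
          ∀ (S : ℝ), 0 ≤ S →
            (∀ b, |(J + QsE (domT hN D hk) (aE (domT hN D hk) w B)) b| ≤ S * ((geomT D).len (blkV1 hN D b) ^ n)⁻¹) →
            ∀ b : PBond (PV d ℓ m K hd hL) 0,
              |A b| ≤ B₀ * (geomT D).len (blkV1 hN D b) ^ 2 * ((geomT D).len (blkV1 hN D b) ^ n)⁻¹ * S := by
  obtain ⟨B₀, N₁, hB₀, hN₁, h⟩ := sup347_of_majorant d ℓ hC hσ n
  refine ⟨B₀, N₁, hB₀, hN₁, ?_⟩
  intro k Mh R hMh1 hRM1 P' hP D m K hd hL hN hk cf hcf w hw hG A J B h55 h42 h56 S hS hX b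
  have hA := eq158_line2_V1 (domT hN D hk) hcf hw A J B h55 h42 h56
  have key := h k Mh R hMh1 hRM1 P' hP D 2 _ (blkV1 hN D) (onFun (GE (domT hN D hk) hcf hw)) hG
    (WithLp.ofLp (J + QsE (domT hN D hk) (aE (domT hN D hk) w B))) S hS hX b
  rw [onFun_apply, WithLp.toLp_ofLp, ← hA] at key
  exact key

end Eq158

end

end Literature.MathematicalPhysics.QuantumFieldTheory.Balaban1983to89.B8Ineq159MultiLevelTorusL0
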